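import Mathlib.Analysis.InnerProductSpace.Basic
import Literature.MathematicalPhysics.QuantumFieldTheory.Balaban1983to89.B4Eq19LatticeCaccioppoli
import HarnessLib

/-!
# Line «poincare_lipschitz» on crux `HistoryTailL` (stmt-QuantumFields-19936), route crux `BlockLipschitzL` (stmt-QuantumFields-23533), K2 organ of record LOC-REG-MIN —
# FLAT SHADOW «SMALL-RANGE DISCRETE REGULARITY INTO A SPHERE», FILE 1: the two structural identities of a one-site-optimal sphere-valued lattice map and the
# SMALL-RANGE CACCIOPPOLI INEQUALITY `Σ_{Q_ρ(z)} Σ_μ ‖u(y+e_μ) − u(y)‖² ≤ 200·d·ω²·#Q_{ρ+s+1}(z)∕s²` (range in a ball of radius `ω` around a unit vector `p`)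

Cell `ym3-torus` (YM ladder rung R3 = continuum SU(2) Yang–Mills on the three-torus — a RUNG, NOT the Clay problem: not d = 4, not infinite volume, not a
mass gap); width seat `ym3-torus-px7` gen 5 (LEAD ym-ust-19936-w1 g8 2026-08-29T04:28:59Z: «px7 g5: ★w5's (3) small-range discrete regularity into S³ by the direct method
— LOCATE → SIGNATURE»; my LOCATE `LOCATE-SMALL-RANGE-S3-px7g5.md` (19936 evidence) §1–§3; ★w5-19936 g11's `LOC-REG-FLAT-SHADOW-LOCATE` §2(c)).  THEOREMS ONLY (def-free), in the
`ℤ^d` letters of lit ✓`B4Eq19LatticeOperators` (`box`, `unitVec`, `lop`, `fdiff`) with values in ANY real inner-product space `V` (the unit sphere of `V`; `V = ℝ⁴ ⊃ S³ ≅ SU(2)` is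
the instance of record); `--supports stmt-QuantumFields-19936`.  Nothing here proves LOC-REG-MIN, hG, the per-bond charts, a stub, `BlockLipschitzL`, `HistoryTailL` or a summit
statement; nothing twisted ∕ covariant is in this file.

OBJECT.  `u : ℤ^d → V` with `‖u(y)‖ = 1`; the NEIGHBOUR SUM `N(x) = Σ_μ (u(x+e_μ) + u(x−e_μ))`; ONE-SITE OPTIMALITY `‖N(x)‖·u(x) = N(x)` (the site-wise Euler–Lagrange
condition of the lattice Dirichlet energy `Σ_b ‖u_x − u_y‖²` under the sphere constraint — what box-ℓ²-orbit MINIMALITY gives site by site; written without an inverse so that it is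
trivially true at `N(x) = 0`); the LOCAL ENERGY `λ(x) = Σ_μ ((1 − ⟪u x, u(x+e_μ)⟫) + (1 − ⟪u x, u(x−e_μ)⟫)) = ½Σ_{y∼x}‖u x − u y‖² ≥ 0`; SMALL RANGE: a unit `p` and
`ω ∈ [0,1]` with `‖u(y) − p‖ ≤ ω` on the relevant box.

* §1 (I1) `one_sub_inner_eq` (`1 − ⟪a,b⟫ = ½‖a − b‖²` for unit vectors), ★ `nbr_sum_sub_eq` — `Σ_μ ((u(x+e_μ) − u x) + (u(x−e_μ) − u x)) = −λ(x)·u(x)`: the discrete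
  `−Δu = |∇u|²u`; `lop_inner_eq` — componentwise: `lop 0 ⟪u ·, q⟫ (x) = λ(x)·⟪u x, q⟫` for every `q`.
* §2 (I2) `inner_sub_eq_inner_sub_midpoint` — the GAUSS-MAP TRICK `⟪u y − u x, p⟫ = ⟪u y − u x, p − ½(u x + u y)⟫` (`‖u x‖ = ‖u y‖`), `abs_fdiff_oneSubInner_le`
  (`|∂_μ(1 − ⟪u,p⟫)(y)| ≤ ω·‖u(y+e_μ) − u y‖`), `inner_ge_half` (`⟪u y, p⟫ ≥ ½` when `‖u y − p‖ ≤ ω ≤ 1`): `g = 1 − ⟪u,p⟫ = ½‖u − p‖²` is FLAT-SUBHARMONIC,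
  `lop 0 g (x) = −λ(x)·⟪u x,p⟫ ≤ 0`.
* §3 ★★ `smallRange_caccioppoli` — the title: testing §2 against the square of the cutoff of ✓`exists_cutoff` (summation by parts ✓`sum_mul_lop`), Young, and absorbing the
  forward energy; NO smallness beyond `ω ≤ 1`, constants `200·d`.
WHAT IT IS FOR (LOCATE §1): the energy is SMALL IN THE SCALE-INVARIANT SENSE at every scale and centre (`ρ^{2−d}E(Q_ρ) ≲ ω²`), the input of the energy-decay iteration (FILE 2,
Giaquinta–Giusti's direct method: harmonic replacement with error `2ω·E`, no weak Harnack) and of the Hölder law `‖u(x₀+e_μ) − u x₀‖ ≤ C_d·ω·R^{−β}` (FILE 3).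
[folklore] ([Giaquinta1984] Ch. VI §1 Thm 1.1 step I, §3 Thm 3.2 (one-sided condition; «essentially the harmonic maps of [163]»); Hildebrandt–Kaul–Widman, Acta Math. 138 (1977) — the
continuum small-range theory; the lattice statements are this file's).
-/

set_option autoImplicit false

noncomputable section

open scoped BigOperators InnerProductSpace
open Finset

namespace Summit.QuantumFields.YangMills.Theorems.PoincareLipschitzSphereMapSmallRangeCaccioppoli

open Literature.MathematicalPhysics.QuantumFieldTheory.Balaban1983to89
open B4Eq19LatticeOperators
open B4Eq19LatticeCaccioppoli (exists_cutoff)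

variable {d : ℕ} {V : Type*} [NormedAddCommGroup V] [InnerProductSpace ℝ V]

/-! ## §1 (I1) The one-site Euler–Lagrange identity: `Σ_{y∼x}(u y − u x) = −λ(x)·u(x)` -/

/-- For unit vectors, `1 − ⟪a, b⟫ = ½‖a − b‖²`. [folklore] -/
theorem one_sub_inner_eq {a b : V} (ha : ‖a‖ = 1) (hb : ‖b‖ = 1) : 1 - ⟪a, b⟫_ℝ = (1 / 2) * ‖a - b‖ ^ 2 := by
  rw [@norm_sub_sq_real, ha, hb]; ring

/-- For unit vectors, `0 ≤ 1 − ⟪a, b⟫`. [folklore] -/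
theorem one_sub_inner_nonneg {a b : V} (ha : ‖a‖ = 1) (hb : ‖b‖ = 1) : 0 ≤ 1 - ⟪a, b⟫_ℝ := by
  rw [one_sub_inner_eq ha hb]; positivity

/-- ★ **(I1) THE DISCRETE `−Δu = |∇u|²u`**: if `‖u x‖ = 1` and `‖N(x)‖·u(x) = N(x)` for the neighbour sum `N(x) = Σ_μ (u(x+e_μ) + u(x−e_μ))` (one-site optimality), then
`Σ_μ ((u(x+e_μ) − u x) + (u(x−e_μ) − u x)) = −λ(x)·u x` with `λ(x) = Σ_μ ((1 − ⟪u x, u(x+e_μ)⟫) + (1 − ⟪u x, u(x−e_μ)⟫))` (`= 2d − ‖N(x)‖`).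
[folklore] [cite: Giaquinta1984, Ch. VI §3 (3.1)–(3.4) p.135 (the continuum equation `−Δu = |∇u|²u`)] -/
theorem nbr_sum_sub_eq (u : Zd d → V) (x : Zd d) (hux : ‖u x‖ = 1)
    (hopt : ‖∑ μ, (u (x + unitVec μ) + u (x - unitVec μ))‖ • u x = ∑ μ, (u (x + unitVec μ) + u (x - unitVec μ))) :
    ∑ μ, ((u (x + unitVec μ) - u x) + (u (x - unitVec μ) - u x)) =
      -(∑ μ, ((1 - ⟪u x, u (x + unitVec μ)⟫_ℝ) + (1 - ⟪u x, u (x - unitVec μ)⟫_ℝ))) • u x := by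
  set N : V := ∑ μ, (u (x + unitVec μ) + u (x - unitVec μ)) with hN
  -- `λ = 2d − ‖N‖` via `⟪u x, N⟫ = ‖N‖`
  have hinner : ⟪u x, N⟫_ℝ = ‖N‖ := by
    conv_lhs => rw [← hopt]
    rw [real_inner_smul_right, real_inner_self_eq_norm_sq, hux]; ring
  have hlam : ∑ μ, ((1 - ⟪u x, u (x + unitVec μ)⟫_ℝ) + (1 - ⟪u x, u (x - unitVec μ)⟫_ℝ)) = 2 * d - ‖N‖ := by
    have e1 : ∑ μ, ((1 - ⟪u x, u (x + unitVec μ)⟫_ℝ) + (1 - ⟪u x, u (x - unitVec μ)⟫_ℝ)) =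
        ∑ _μ : Fin d, (2 : ℝ) - ∑ μ, ⟪u x, u (x + unitVec μ) + u (x - unitVec μ)⟫_ℝ := by
      rw [← Finset.sum_sub_distrib]
      exact Finset.sum_congr rfl fun μ _ => by rw [inner_add_right]; ring
    rw [e1, ← inner_sum, ← hN, hinner, Finset.sum_const, Finset.card_univ, Fintype.card_fin, nsmul_eq_mul]
    ring
  have hsum : ∑ μ, ((u (x + unitVec μ) - u x) + (u (x - unitVec μ) - u x)) = N - (2 * (d : ℝ)) • u x := by
    have e1 : ∑ μ, ((u (x + unitVec μ) - u x) + (u (x - unitVec μ) - u x)) = ∑ μ, ((u (x + unitVec μ) + u (x - unitVec μ)) - (2 : ℝ) • u x) :=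
      Finset.sum_congr rfl fun μ _ => by rw [two_smul]; abel
    rw [e1, Finset.sum_sub_distrib, ← hN, Finset.sum_const, Finset.card_univ, Fintype.card_fin, ← Nat.cast_smul_eq_nsmul ℝ, smul_smul,
      mul_comm]
  rw [hsum, hlam, neg_smul, sub_smul, hopt]
  abel

/-- **(I1) COMPONENTWISE**: under the hypotheses of `nbr_sum_sub_eq`, for every `q`: `lop 0 ⟪u ·, q⟫ (x) = λ(x)·⟪u x, q⟫`. [folklore]
[cite: Giaquinta1984, Ch. VI §3 (3.1) p.135] -/
theorem lop_inner_eq (u : Zd d → V) (x : Zd d) (q : V) (hux : ‖u x‖ = 1)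
    (hopt : ‖∑ μ, (u (x + unitVec μ) + u (x - unitVec μ))‖ • u x = ∑ μ, (u (x + unitVec μ) + u (x - unitVec μ))) :
    lop 0 (fun z => ⟪u z, q⟫_ℝ) x = (∑ μ, ((1 - ⟪u x, u (x + unitVec μ)⟫_ℝ) + (1 - ⟪u x, u (x - unitVec μ)⟫_ℝ))) * ⟪u x, q⟫_ℝ := by
  have h := nbr_sum_sub_eq u x hux hopt
  have e1 : lop 0 (fun z => ⟪u z, q⟫_ℝ) x = -⟪∑ μ, ((u (x + unitVec μ) - u x) + (u (x - unitVec μ) - u x)), q⟫_ℝ := by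
    rw [lop_apply, zero_mul, add_zero, sum_inner, ← Finset.sum_neg_distrib]
    refine Finset.sum_congr rfl fun μ _ => ?_
    rw [inner_add_left, inner_sub_left, inner_sub_left]; ring
  rw [e1, h, real_inner_smul_left]; ring

/-! ## §2 (I2) The Gauss-map trick: `½‖u − p‖²` is flat-subharmonic, with `ω`-small differences -/

/-- **(I2) THE GAUSS-MAP TRICK**: for `‖u x‖ = ‖u y‖`, `⟪u y − u x, p⟫ = ⟪u y − u x, p − ½(u x + u y)⟫`. [folklore] -/
theorem inner_sub_eq_inner_sub_midpoint {a b : V} (ha : ‖a‖ = 1) (hb : ‖b‖ = 1) (p : V) :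
    ⟪b - a, p⟫_ℝ = ⟪b - a, p - (1 / 2 : ℝ) • (a + b)⟫_ℝ := by
  have h0 : ⟪b - a, a + b⟫_ℝ = 0 := by
    rw [inner_sub_left, inner_add_right, inner_add_right, real_inner_self_eq_norm_sq, real_inner_self_eq_norm_sq, ha, hb,
      real_inner_comm a b]
    ring
  rw [inner_sub_right, real_inner_smul_right, h0, mul_zero, sub_zero]

/-- The differences of `g = 1 − ⟪u, p⟫` are `ω`-small multiples of the differences of `u`: if `‖u y‖ = ‖u y'‖ = 1` and both are within `ω` of `p`, then
`|(1 − ⟪u y', p⟫) − (1 − ⟪u y, p⟫)| ≤ ω·‖u y' − u y‖`. [folklore] -/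
theorem abs_sub_oneSubInner_le {a b p : V} (ha : ‖a‖ = 1) (hb : ‖b‖ = 1) {ω : ℝ} (hap : ‖a - p‖ ≤ ω) (hbp : ‖b - p‖ ≤ ω) :
    |(1 - ⟪b, p⟫_ℝ) - (1 - ⟪a, p⟫_ℝ)| ≤ ω * ‖b - a‖ := by
  have e : (1 - ⟪b, p⟫_ℝ) - (1 - ⟪a, p⟫_ℝ) = -⟪b - a, p - (1 / 2 : ℝ) • (a + b)⟫_ℝ := by
    rw [← inner_sub_eq_inner_sub_midpoint ha hb p, inner_sub_left]; ring
  rw [e, abs_neg]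
  have hmid : ‖p - (1 / 2 : ℝ) • (a + b)‖ ≤ ω := by
    have e2 : p - (1 / 2 : ℝ) • (a + b) = (1 / 2 : ℝ) • (p - a) + (1 / 2 : ℝ) • (p - b) := by
      rw [smul_sub, smul_sub, smul_add]; module
    rw [e2]
    calc ‖(1 / 2 : ℝ) • (p - a) + (1 / 2 : ℝ) • (p - b)‖ ≤ ‖(1 / 2 : ℝ) • (p - a)‖ + ‖(1 / 2 : ℝ) • (p - b)‖ := norm_add_le _ _
      _ = (1 / 2) * ‖a - p‖ + (1 / 2) * ‖b - p‖ := by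
          rw [norm_smul, norm_smul, Real.norm_of_nonneg (by norm_num : (0:ℝ) ≤ 1 / 2), norm_sub_rev p a, norm_sub_rev p b]
      _ ≤ (1 / 2) * ω + (1 / 2) * ω := add_le_add (by linarith) (by linarith)
      _ = ω := by ring
  calc |⟪b - a, p - (1 / 2 : ℝ) • (a + b)⟫_ℝ| ≤ ‖b - a‖ * ‖p - (1 / 2 : ℝ) • (a + b)‖ := abs_real_inner_le_norm _ _
    _ ≤ ‖b - a‖ * ω := mul_le_mul_of_nonneg_left hmid (norm_nonneg _)
    _ = ω * ‖b - a‖ := mul_comm _ _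

/-- In a ball of radius `ω ≤ 1` around a unit vector, `⟪u, p⟫ ≥ ½` (`⟪a,p⟫ = 1 − ½‖a − p‖²`). [folklore] -/
theorem inner_ge_half {a p : V} (ha : ‖a‖ = 1) (hp : ‖p‖ = 1) {ω : ℝ} (hap : ‖a - p‖ ≤ ω) (hω1 : ω ≤ 1) : (1 / 2 : ℝ) ≤ ⟪a, p⟫_ℝ := by
  have e : ⟪a, p⟫_ℝ = 1 - (1 / 2) * ‖a - p‖ ^ 2 := by linarith [one_sub_inner_eq ha hp]
  have hω0 : 0 ≤ ω := (norm_nonneg _).trans hap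
  have h2 : ‖a - p‖ ^ 2 ≤ 1 := by
    calc ‖a - p‖ ^ 2 ≤ ω ^ 2 := pow_le_pow_left₀ (norm_nonneg _) hap 2
      _ ≤ 1 := pow_le_one₀ hω0 hω1
  rw [e]; linarith

/-- **(I2) FLAT SUBHARMONICITY OF `½‖u − p‖²`**: under one-site optimality at `x` (and `‖u x‖ = 1`), `lop 0 (1 − ⟪u ·, p⟫)(x) = −λ(x)·⟪u x, p⟫`, which is `≤ 0` as
soon as `⟪u x, p⟫ ≥ 0` (the range in the hemisphere of `p`) — the discrete `Δ(½|u − p|²) = |∇u|²(u·p) ≥ 0`. [folklore]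
[cite: Giaquinta1984, Ch. VI §3 p.136 («|u|² is a subsolution for an elliptic operator»)] -/
theorem lop_oneSubInner_eq (u : Zd d → V) (x : Zd d) (p : V) (hux : ‖u x‖ = 1)
    (hopt : ‖∑ μ, (u (x + unitVec μ) + u (x - unitVec μ))‖ • u x = ∑ μ, (u (x + unitVec μ) + u (x - unitVec μ))) :
    lop 0 (fun z => 1 - ⟪u z, p⟫_ℝ) x = -((∑ μ, ((1 - ⟪u x, u (x + unitVec μ)⟫_ℝ) + (1 - ⟪u x, u (x - unitVec μ)⟫_ℝ))) * ⟪u x, p⟫_ℝ) := by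
  have h := lop_inner_eq u x p hux hopt
  have e : lop 0 (fun z => 1 - ⟪u z, p⟫_ℝ) x = -lop 0 (fun z => ⟪u z, p⟫_ℝ) x := by
    simp only [lop_apply, zero_mul, add_zero, ← Finset.sum_neg_distrib]
    exact Finset.sum_congr rfl fun μ _ => by ring
  rw [e, h]

/-! ## §3 ★★ The small-range Caccioppoli inequality -/

/-- Young's inequality in the form `A·B ≤ t·A² + B²∕(4t)` (`t > 0`). [folklore] -/
theorem young_mul_le (A B : ℝ) {t : ℝ} (ht : 0 < t) : A * B ≤ t * A ^ 2 + B ^ 2 / (4 * t) := by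
  have key : 4 * t * (A * B) ≤ 4 * t * (t * A ^ 2) + B ^ 2 := by nlinarith [sq_nonneg (2 * t * A - B)]
  have h4t : (0 : ℝ) < 4 * t := by positivity
  calc A * B = (4 * t * (A * B)) / (4 * t) := by field_simp
    _ ≤ (4 * t * (t * A ^ 2) + B ^ 2) / (4 * t) := div_le_div_of_nonneg_right key h4t.le
    _ = t * A ^ 2 + B ^ 2 / (4 * t) := by field_simp

/-- The bond-wise real-variable bookkeeping of `smallRange_caccioppoli`: with `s ≥ 1`, `0 ≤ D ≤ 2ω`, `ω ≥ 0`, `χ' ≤ χ + 1∕s`: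
`(1∕s)(χ' + χ)·(ωD) ≤ (1∕8)·χ²D² + (73∕3)·ω²∕s²`. [folklore] -/
theorem bond_young_le {s ω D χ χ' : ℝ} (hs : 1 ≤ s) (hω0 : 0 ≤ ω) (hD0 : 0 ≤ D) (hD2 : D ≤ 2 * ω) (hχ' : χ' ≤ χ + 1 / s) :
    (1 / s) * (χ' + χ) * (ω * D) ≤ (1 / 8) * (χ ^ 2 * D ^ 2) + (1 / 3 + 24) * (ω ^ 2 / s ^ 2) := by
  have hs0 : 0 < s := by linarith
  have eAB : (1 / s) * χ * (ω * D) = (χ * D) * (ω / s) := by ring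
  have eB : (ω / s) ^ 2 = ω ^ 2 / s ^ 2 := by rw [div_pow]
  have hωs : 0 ≤ ω ^ 2 / s ^ 2 := by positivity
  -- piece 1: the `χ` term, twice (with `t = 1/24` and `t = 1/12`)
  have p1 : (1 / s) * χ * (ω * D) ≤ (1 / 24) * (χ ^ 2 * D ^ 2) + 6 * (ω ^ 2 / s ^ 2) := by
    rw [eAB]
    have h := young_mul_le (χ * D) (ω / s) (t := 1 / 24) (by norm_num)
    rw [eB, mul_pow] at h
    have e : (ω ^ 2 / s ^ 2) / (4 * (1 / 24)) = 6 * (ω ^ 2 / s ^ 2) := by ring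
    linarith only [h, e.le, e.ge]
  have q3 : (1 / s) * χ * (ω * D) ≤ (1 / 12) * (χ ^ 2 * D ^ 2) + 3 * (ω ^ 2 / s ^ 2) := by
    rw [eAB]
    have h := young_mul_le (χ * D) (ω / s) (t := 1 / 12) (by norm_num)
    rw [eB, mul_pow] at h
    have e : (ω ^ 2 / s ^ 2) / (4 * (1 / 12)) = 3 * (ω ^ 2 / s ^ 2) := by ring
    linarith only [h, e.le, e.ge]
  -- piece 2: the `χ'` term
  have hωD : 0 ≤ ω * D := by positivity
  have q1 : (1 / s) * χ' * (ω * D) ≤ (1 / s) * (χ + 1 / s) * (ω * D) :=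
    mul_le_mul_of_nonneg_right (mul_le_mul_of_nonneg_left hχ' (by positivity)) hωD
  have q2 : (1 / s) * (1 / s) * (ω * D) ≤ 2 * (ω ^ 2 / s ^ 2) := by
    have : ω * D ≤ 2 * ω ^ 2 := by nlinarith
    have e : (1 / s) * (1 / s) = 1 / s ^ 2 := by field_simp
    rw [e]
    calc 1 / s ^ 2 * (ω * D) ≤ 1 / s ^ 2 * (2 * ω ^ 2) := mul_le_mul_of_nonneg_left this (by positivity)
      _ = 2 * (ω ^ 2 / s ^ 2) := by ring
  have e1 : (1 / s) * (χ + 1 / s) * (ω * D) = (1 / s) * χ * (ω * D) + (1 / s) * (1 / s) * (ω * D) := by ring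
  have e2 : (1 / s) * (χ' + χ) * (ω * D) = (1 / s) * χ * (ω * D) + (1 / s) * χ' * (ω * D) := by ring
  rw [e2]
  linarith only [p1, q1, q2, q3, e1.le, e1.ge, hωs]


/-- ★★ **THE SMALL-RANGE CACCIOPPOLI INEQUALITY FOR ONE-SITE-OPTIMAL SPHERE-VALUED LATTICE MAPS.**  `d ≥ 1`, `ρ ≥ 0`, `s ≥ 1`; `u : ℤ^d → V` with `‖u‖ = 1` and range
`‖u − p‖ ≤ ω` on `Q_{ρ+s+2}(z)` (`‖p‖ = 1`, `0 ≤ ω ≤ 1`), one-site optimal (`‖N‖·u = N`) on `Q_{ρ+s+1}(z)`.  Then the forward lattice energy on `Q_ρ(z)` obeys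
`Σ_{y ∈ Q_ρ(z)} Σ_μ ‖u(y+e_μ) − u(y)‖² ≤ 200·d·ω²·(2(ρ+s+1)+1)^d ∕ s²` — at `s = ρ+1`: `E(Q_ρ) ≲_d ρ^{d−2}·ω²`, energy SMALL IN THE SCALE-INVARIANT SENSE at every scale.  Proof:
test the subharmonicity (I2) of `g = 1 − ⟪u,p⟫` against `χ²` (✓`exists_cutoff`, ✓`sum_mul_lop`), bound `|∂χ²|·|∂g| ≤ (1∕s)(χ(y+e)+χ(y))·ω‖∂u‖` (Gauss-map trick), Young, and absorb
(`⟪u,p⟫ ≥ ½`, `χ(y+e_μ)² ≤ 2χ(y)² + 2∕s²`, `‖∂u‖ ≤ 2ω`).  NO smallness of `ω` beyond `ω ≤ 1`.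
[folklore] [cite: Giaquinta1984, Ch. VI §1 Thm 1.1 (step I, Caccioppoli) p.128, §3 Thm 3.2 p.137] -/
theorem smallRange_caccioppoli (hd : 1 ≤ d) (u : Zd d → V) (p : V) (hp : ‖p‖ = 1) (z : Zd d) {ρ s : ℤ} (hρ : 0 ≤ ρ) (hs : 1 ≤ s) {ω : ℝ}
    (hω0 : 0 ≤ ω) (hω1 : ω ≤ 1)
    (hu1 : ∀ y ∈ box z (ρ + s + 2), ‖u y‖ = 1) (hω : ∀ y ∈ box z (ρ + s + 2), ‖u y - p‖ ≤ ω)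
    (hopt : ∀ y ∈ box z (ρ + s + 1),
      ‖∑ μ, (u (y + unitVec μ) + u (y - unitVec μ))‖ • u y = ∑ μ, (u (y + unitVec μ) + u (y - unitVec μ))) :
    ∑ y ∈ box z ρ, ∑ μ, ‖u (y + unitVec μ) - u y‖ ^ 2 ≤ 200 * d * ω ^ 2 * ((2 * (ρ + s + 1) + 1 : ℤ) : ℝ) ^ d / (s : ℝ) ^ 2 := by
  classical
  obtain ⟨χ, hχ0, hχ1, hχin, hχout, hχlip⟩ := exists_cutoff z hρ hs
  set R : ℤ := ρ + s + 1 with hR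
  have hs0 : (0 : ℝ) < s := by exact_mod_cast (show (0 : ℤ) < s by linarith)
  have hdR : (1 : ℝ) ≤ d := by exact_mod_cast hd
  -- letters
  set g : Zd d → ℝ := fun y => 1 - ⟪u y, p⟫_ℝ with hg
  set lam : Zd d → ℝ := fun y => ∑ μ, ((1 - ⟪u y, u (y + unitVec μ)⟫_ℝ) + (1 - ⟪u y, u (y - unitVec μ)⟫_ℝ)) with hlam
  set φ : Zd d → ℝ := fun y => χ y ^ 2 with hφ
  set F : ℝ := ∑ y ∈ box z R, χ y ^ 2 * ∑ μ, ‖u (y + unitVec μ) - u y‖ ^ 2 with hF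
  -- memberships
  have hRsub1 : box z R ⊆ box z (ρ + s + 1) := by rw [hR]
  have hmem2 : ∀ y ∈ box z R, y ∈ box z (ρ + s + 2) := fun y hy => box_mono z (by rw [hR]; linarith) hy
  have hmem2p : ∀ y ∈ box z R, ∀ μ, y + unitVec μ ∈ box z (ρ + s + 2) := fun y hy μ => by
    have := add_unitVec_mem_box hy μ; rw [hR] at this; simpa [add_assoc] using this
  have hmem2m : ∀ y ∈ box z R, ∀ μ, y - unitVec μ ∈ box z (ρ + s + 2) := fun y hy μ => by
    have := sub_unitVec_mem_box hy μ; rw [hR] at this; simpa [add_assoc] using this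
  have hφ0 : ∀ y ∉ box z (R - 1), φ y = 0 := fun y hy => by
    have : χ y = 0 := hχout y (by rw [hR] at hy; simpa using hy)
    simp [hφ, this]
  -- §a: summation by parts: `Σ χ² lop g = Σ Σ_μ ∂χ² ∂g`
  have hSBP := sum_mul_lop 0 φ g z R hφ0
  simp only [zero_mul, add_zero] at hSBP
  -- §b: the left side is `−Σ χ² λ ⟪u,p⟫`
  have hL : ∑ y ∈ box z R, φ y * lop 0 g y = -∑ y ∈ box z R, χ y ^ 2 * (lam y * ⟪u y, p⟫_ℝ) := by
    rw [← Finset.sum_neg_distrib]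
    refine Finset.sum_congr rfl fun y hy => ?_
    rw [hg, lop_oneSubInner_eq u y p (hu1 y (hmem2 y hy)) (hopt y (hRsub1 hy)), hφ, hlam]
    ring
  -- §c: lower bound of the left side by `F/4`
  have hlam_lb : ∀ y ∈ box z R, (1 / 2) * ∑ μ, ‖u (y + unitVec μ) - u y‖ ^ 2 ≤ lam y := by
    intro y hy
    rw [hlam, Finset.mul_sum]
    refine Finset.sum_le_sum fun μ _ => ?_
    have h1 := one_sub_inner_eq (hu1 y (hmem2 y hy)) (hu1 _ (hmem2p y hy μ))
    have h2 := one_sub_inner_nonneg (hu1 y (hmem2 y hy)) (hu1 _ (hmem2m y hy μ))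
    rw [norm_sub_rev] at h1
    linarith
  have hLB : (1 / 4) * F ≤ ∑ y ∈ box z R, χ y ^ 2 * (lam y * ⟪u y, p⟫_ℝ) := by
    rw [hF, Finset.mul_sum]
    refine Finset.sum_le_sum fun y hy => ?_
    have hip : (1 / 2 : ℝ) ≤ ⟪u y, p⟫_ℝ := inner_ge_half (hu1 y (hmem2 y hy)) hp (hω y (hmem2 y hy)) hω1
    have hl := hlam_lb y hy
    have hE0 : 0 ≤ ∑ μ, ‖u (y + unitVec μ) - u y‖ ^ 2 := Finset.sum_nonneg fun _ _ => sq_nonneg _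
    have hlam0 : 0 ≤ lam y := le_trans (by positivity) hl
    calc (1 / 4) * (χ y ^ 2 * ∑ μ, ‖u (y + unitVec μ) - u y‖ ^ 2) = χ y ^ 2 * (((1 / 2) * ∑ μ, ‖u (y + unitVec μ) - u y‖ ^ 2) * (1 / 2)) := by ring
      _ ≤ χ y ^ 2 * (lam y * ⟪u y, p⟫_ℝ) := mul_le_mul_of_nonneg_left (mul_le_mul hl hip (by norm_num) hlam0) (sq_nonneg _)
  -- §d: upper bound of the right side, bond by bond
  have hbond : ∀ y ∈ box z R, ∀ μ : Fin d, -(fdiff μ φ y * fdiff μ g y) ≤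
      (1 / 8) * (χ y ^ 2 * ‖u (y + unitVec μ) - u y‖ ^ 2) + (1 / 3 + 24) * (ω ^ 2 / (s : ℝ) ^ 2) := by
    intro y hy μ
    have huy := hu1 y (hmem2 y hy)
    have huy' := hu1 _ (hmem2p y hy μ)
    have hωy := hω y (hmem2 y hy)
    have hωy' := hω _ (hmem2p y hy μ)
    set D : ℝ := ‖u (y + unitVec μ) - u y‖ with hD
    have hD0 : 0 ≤ D := norm_nonneg _
    have hD2 : D ≤ 2 * ω := by
      calc D = ‖(u (y + unitVec μ) - p) - (u y - p)‖ := by rw [hD]; congr 1; abel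
        _ ≤ ‖u (y + unitVec μ) - p‖ + ‖u y - p‖ := norm_sub_le _ _
        _ ≤ ω + ω := add_le_add hωy' hωy
        _ = 2 * ω := by ring
    -- the two factors
    have hdg : |fdiff μ g y| ≤ ω * D := by
      rw [fdiff_apply, hg]; exact abs_sub_oneSubInner_le huy huy' hωy hωy'
    have hdφ : |fdiff μ φ y| ≤ (1 / s) * (χ (y + unitVec μ) + χ y) := by
      rw [fdiff_apply, hφ]
      have e : χ (y + unitVec μ) ^ 2 - χ y ^ 2 = (χ (y + unitVec μ) - χ y) * (χ (y + unitVec μ) + χ y) := by ring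
      rw [e, abs_mul, abs_of_nonneg (add_nonneg (hχ0 _) (hχ0 _))]
      exact mul_le_mul_of_nonneg_right (hχlip y μ) (add_nonneg (hχ0 _) (hχ0 _))
    have hprod : -(fdiff μ φ y * fdiff μ g y) ≤ (1 / s) * (χ (y + unitVec μ) + χ y) * (ω * D) := by
      calc -(fdiff μ φ y * fdiff μ g y) ≤ |fdiff μ φ y * fdiff μ g y| := neg_le_abs _
        _ = |fdiff μ φ y| * |fdiff μ g y| := abs_mul _ _
        _ ≤ (1 / s) * (χ (y + unitVec μ) + χ y) * (ω * D) :=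
            mul_le_mul hdφ hdg (abs_nonneg _) (mul_nonneg (by positivity) (add_nonneg (hχ0 _) (hχ0 _)))
    -- the real-variable bookkeeping
    have hχ' : χ (y + unitVec μ) ≤ χ y + 1 / s := by linarith [(abs_le.1 (hχlip y μ)).2]
    have hs1 : (1 : ℝ) ≤ s := by exact_mod_cast hs
    have hY := bond_young_le hs1 hω0 hD0 hD2 hχ'
    have hD' : χ y ^ 2 * D ^ 2 = χ y ^ 2 * ‖u (y + unitVec μ) - u y‖ ^ 2 := by rw [hD]
    rw [← hD']
    exact hprod.trans hY
  -- §e: sum the bond bounds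
  have hRHS : -(∑ y ∈ box z R, ∑ μ, fdiff μ φ y * fdiff μ g y) ≤ (1 / 8) * F + (1 / 3 + 24) * (ω ^ 2 / (s : ℝ) ^ 2) * (d * ((box z R).card : ℝ)) := by
    have h1 : -(∑ y ∈ box z R, ∑ μ, fdiff μ φ y * fdiff μ g y) = ∑ y ∈ box z R, ∑ μ, -(fdiff μ φ y * fdiff μ g y) := by
      rw [← Finset.sum_neg_distrib]
      exact Finset.sum_congr rfl fun y _ => by rw [Finset.sum_neg_distrib]
    rw [h1]
    have S1 : ∑ y ∈ box z R, ∑ μ : Fin d, (1 / 8) * (χ y ^ 2 * ‖u (y + unitVec μ) - u y‖ ^ 2) = (1 / 8) * F := by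
      rw [hF, Finset.mul_sum]
      refine Finset.sum_congr rfl fun y _ => ?_
      rw [Finset.mul_sum, Finset.mul_sum]
    have S2 : ∑ _y ∈ box z R, ∑ _μ : Fin d, (1 / 3 + 24) * (ω ^ 2 / (s : ℝ) ^ 2) =
        (1 / 3 + 24) * (ω ^ 2 / (s : ℝ) ^ 2) * (d * ((box z R).card : ℝ)) := by
      simp only [Finset.sum_const, Finset.card_univ, Fintype.card_fin, nsmul_eq_mul]
      ring
    calc ∑ y ∈ box z R, ∑ μ, -(fdiff μ φ y * fdiff μ g y)
        ≤ ∑ y ∈ box z R, ∑ μ : Fin d, ((1 / 8) * (χ y ^ 2 * ‖u (y + unitVec μ) - u y‖ ^ 2) + (1 / 3 + 24) * (ω ^ 2 / (s : ℝ) ^ 2)) :=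
          Finset.sum_le_sum fun y hy => Finset.sum_le_sum fun μ _ => hbond y hy μ
      _ = (1 / 8) * F + (1 / 3 + 24) * (ω ^ 2 / (s : ℝ) ^ 2) * (d * ((box z R).card : ℝ)) := by
          rw [← S1, ← S2, ← Finset.sum_add_distrib]
          exact Finset.sum_congr rfl fun y _ => Finset.sum_add_distrib
  -- §f: assemble `F/4 ≤ F/8 + (73/3)·d·#Q_R·ω²/s²`
  have hmain : (1 / 4) * F ≤ (1 / 8) * F + (1 / 3 + 24) * (ω ^ 2 / (s : ℝ) ^ 2) * (d * ((box z R).card : ℝ)) := by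
    have := hLB
    rw [← neg_neg (∑ y ∈ box z R, χ y ^ 2 * (lam y * ⟪u y, p⟫_ℝ)), ← hL, hSBP] at this
    exact this.trans hRHS
  have hcard : ((box z R).card : ℝ) = ((2 * (ρ + s + 1) + 1 : ℤ) : ℝ) ^ d := by rw [card_box z (by rw [hR]; linarith), hR]
  have hF_le : F ≤ 200 * d * ω ^ 2 * ((2 * (ρ + s + 1) + 1 : ℤ) : ℝ) ^ d / (s : ℝ) ^ 2 := by
    rw [hcard] at hmain
    have hρR : (0 : ℝ) ≤ ρ := by exact_mod_cast hρ
    set X : ℝ := (ω ^ 2 / (s : ℝ) ^ 2) * ((d : ℝ) * ((2 * (ρ + s + 1) + 1 : ℤ) : ℝ) ^ d) with hX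
    have hX0 : 0 ≤ X := by
      have : (0 : ℝ) ≤ ((2 * (ρ + s + 1) + 1 : ℤ) : ℝ) ^ d := by apply pow_nonneg; push_cast; linarith
      rw [hX]; positivity
    have e : 200 * d * ω ^ 2 * ((2 * (ρ + s + 1) + 1 : ℤ) : ℝ) ^ d / (s : ℝ) ^ 2 = 200 * X := by rw [hX]; ring
    rw [e]
    linarith only [hmain, hX0]
  -- §g: the forward energy on `Q_ρ` is below `F`
  calc ∑ y ∈ box z ρ, ∑ μ, ‖u (y + unitVec μ) - u y‖ ^ 2 = ∑ y ∈ box z ρ, χ y ^ 2 * ∑ μ, ‖u (y + unitVec μ) - u y‖ ^ 2 := by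
        refine Finset.sum_congr rfl fun y hy => ?_
        rw [hχin y (box_mono z (by linarith) hy), one_pow, one_mul]
    _ ≤ F := by
        rw [hF]
        exact Finset.sum_le_sum_of_subset_of_nonneg (box_mono z (by rw [hR]; linarith))
          fun y _ _ => mul_nonneg (sq_nonneg _) (Finset.sum_nonneg fun _ _ => sq_nonneg _)
    _ ≤ _ := hF_le

end Summit.QuantumFields.YangMills.Theorems.PoincareLipschitzSphereMapSmallRangeCaccioppoli

end
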